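import Summits.HubbardSuperconductivity.HubbardSuperconductivity.Theorems.AnisotropyChordTransferFibre3Resolvent

/-!
# Route `AnisotropyChord` / H0 rotor rung: PORT SPEC N30-A, REVISED TARGETS (theory seat's PartN30.lean update of 14:20Z)

The theory seat `hubbard-h0-rotor-theory-1` (cycle 20, memo ROTOR-THEORY-20 §279–§287) revised the statement file
PartN30.lean (sha16 d95def70273dfaee) AFTER its first version was landed as `…TransferFibre3` (p722774, sha16 cd7f6c0098bb7415).
Tree files are append-only, so the REVISED theorem targets are landed here under new names where the bodies changed,
verbatim otherwise:
* `KreinThreeV2` (was `KreinThree`): now for every `T < 2ε₁` WITH the hypothesis `(𝒩(T)).det ≠ 0` (the invertibility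
  remark of prover REPORT 3 adopted), also `T ≤ 0`;
* `PhiAntitone`, `NInvertibleBelow` (new);
* `CertLogicV2` (was `CertLogic`): single evaluation `T* < Φ(T*)` + `KreinThreeV2` + `PhiAntitone` + `NInvertibleBelow T*`
  + a `K = 0` trial ⇒ `GM3Fibre` (NOBIND dropped: it follows);
* the Krein–JF identity layer (`kreinCharge`, `residual`, `Gform`, `saddleS`, `KreinJFIdentity`), the master-inequality
  ingredients (`ShellDirichletBound`, `poleWave`, `PoleComplementGap`), the closed-form trial-gap layer (`prodState`,
  `DiscreteIMS`, `dft`, `TwoMagnonFourier`) and the two ∀L cruxes (`IsTwoMagnon`, `trialK1`, `Tplus`, `betaOverlap`,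
  `TrialGapLB`, `offPoleResidual`, `OffPoleResidualUB`, `KTAssembly`) — verbatim; `vfun` is the one already landed
  in `…TransferFibre3Resolvent` (identical body).
Prover seat `hubbard-h0-rotor-p1` g21; helper for stmt-HubbardSuperconductivity-19089 (`--supports`).  Statements only;
`certLogicV2_holds` and the forward half of `KreinThreeV2` are proved in `…TransferFibre3KreinV2`.
-/

set_option linter.dupNamespace false
set_option autoImplicit false

noncomputable section

open scoped BigOperators
open Complex

namespace Summit.HubbardSuperconductivity.HubbardSuperconductivity.Theorems.AnisotropyChord.Transfer.Fibre3

variable (L : ℕ) [NeZero L]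

/-- THEOREM KREIN-3 (port target): for `T < 2ε₁` (so that every non-pole free level exceeds
`E = ε₁ + T`, by `freeGap_K1`), `0 < Δ`, and `𝒩(T)` invertible, `ε₁ + T` is an eigenvalue of the
symmetric hard-core `K₁` sector iff `T` is a fixed point of `Φ` (memo 20 §277(a); valid also for `T ≤ 0`). -/
def KreinThreeV2 (Δ : ℝ) : Prop :=
  ∀ T : ℝ, T < 2 * eps1 L → (Nmat L T Δ).det ≠ 0 →
    (IsSectorEigenvalue L (K1 L) Δ (eps1 L + T) ↔ Phi L T Δ = T)

/-- LEMMA ANTITONE (port target, memo 20 §279(b),(d)): on any interval where `𝒩` stays invertible,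
`Φ` is non-increasing (`3V²Φ' = −⟨x, (G_T²)| x⟩ ≤ 0`, resolvent identity). -/
def PhiAntitone (Δ : ℝ) : Prop :=
  ∀ T₁ T₂ : ℝ, T₁ ≤ T₂ → T₂ < 2 * eps1 L →
    (∀ T ∈ Set.Icc T₁ T₂, (Nmat L T Δ).det ≠ 0) → Phi L T₂ Δ ≤ Phi L T₁ Δ

/-- INVERTIBILITY (port target, memo 20 §279(d)): `𝒩(T)` is invertible for all `T ≤ T*` whenever
`P = G_DD > 0` and the Schur complement `Q̃ = Q_S + B P⁻¹ Bᴴ > 0` — the latter is LEMMA L2/κ₀ for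
`T < ε₁(1 − 5/V + 6/V²)/2`. Stated here as the bare conclusion needed downstream. -/
def NInvertibleBelow (Δ Tstar : ℝ) : Prop :=
  ∀ T : ℝ, T ≤ Tstar → (Nmat L T Δ).det ≠ 0

/-- CERTIFICATE LOGIC (port target): a SINGLE evaluation `Φ(T*) > T*` (what (CERT′) certifies at
`T* = T⁺`), invertibility of `𝒩` below `T*`, antitonicity and KREIN-3, together with a `K = 0`
admissible trial function of Rayleigh quotient `≤ T*` (the Jastrow–Feynman product state), give
`GM3Fibre`: every symmetric `K₁` level then exceeds `ε₁ + T* ≥ ε₁ + t₀` (this includes NOBIND: no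
level at or below `ε₁`). -/
def CertLogicV2 (Δ : ℝ) : Prop :=
  ∀ Tstar : ℝ, 0 < Tstar → Tstar < 2 * eps1 L →
    KreinThreeV2 L Δ → PhiAntitone L Δ → NInvertibleBelow L Δ Tstar →
    Tstar < Phi L Tstar Δ →
    (∃ G : Cfg L → ℂ, Admissible L 0 G ∧ RQ L 0 Δ G ≤ Tstar) →
    GM3Fibre L Δ

/-! ## The Krein–JF identity (memo 20 §282) — port target
For a symmetric trial function `Ψ` vanishing on `D`, normalised by `⟨v,Ψ⟩ = 3V²`, with eigen-residual
`R' = 1_{Dᶜ}(H − E)Ψ` and Krein charge `ρ₀ = 1_D (H₀ − E)Ψ ⊕ ΔWΨ|_S`, the saddle functional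
`S(x) = 2Re⟨x,v⟩ − ⟨x,𝒩x⟩` evaluated at `x = −ρ₀` equals `3V²T + ⟨Ψ,(H−E)Ψ⟩ − ⟨R',G R'⟩` EXACTLY
(checked to 1e-14, cycle20/calc/krein_identity.py). Combined with `3V²Φ = S(𝒩⁻¹v) ≥ S(x) − (penalty)` this is a
Temple-type inequality in the Krein metric: `3V²(Φ(T) − T) ≥ ⟨Ψ,(H−E)Ψ⟩ − ⟨R',GR'⟩ − ⟨ẽ,Q̃⁻¹ẽ⟩`, `e = (GR')|_{D⊕S}`. -/

/-- the trial function read as a vector on `D ⊕ S` is not needed; its Krein charge is: on `D` the value of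
`(H₀ − E)Ψ` (note `WΨ = 0` there since `Ψ|_D = 0`), on `S` the potential charge `Δ·W·Ψ`. -/
noncomputable def kreinCharge (T Δ : ℝ) (Ψ : Cfg L → ℂ) : DS L → ℂ := fun i =>
  match i with
  | Sum.inl c => H0apply L (K1 L) Ψ c.1 - ((eps1 L + T : ℝ) : ℂ) * Ψ c.1
  | Sum.inr c => (Δ : ℂ) * (Wcount L c.1 : ℂ) * Ψ c.1

/-- off-`D` eigen-residual `R' = 1_{Dᶜ} (H − E) Ψ`, `E = ε₁ + T`. -/
noncomputable def residual (T Δ : ℝ) (Ψ : Cfg L → ℂ) : Cfg L → ℂ := fun c =>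
  if InD L c then 0 else Happly L (K1 L) Δ Ψ c - ((eps1 L + T : ℝ) : ℂ) * Ψ c

/-- `⟨A, G_T B⟩` with the pole-removed free resolvent kernel `Gentry`. -/
noncomputable def Gform (T : ℝ) (A B : Cfg L → ℂ) : ℂ :=
  ∑ c : Cfg L, ∑ c' : Cfg L, (starRingEnd ℂ) (A c) * Gentry L T c c' * B c'

/-- the saddle functional `S(x) = 2 Re⟨x, v⟩ − ⟨x, 𝒩 x⟩` on `D ⊕ S`. -/
noncomputable def saddleS (T Δ : ℝ) (x : DS L → ℂ) : ℝ :=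
  2 * (star x ⬝ᵥ vpole L).re - (star x ⬝ᵥ (Nmat L T Δ).mulVec x).re

/-- THE KREIN–JF IDENTITY (port target, memo 20 §282): exact, for every symmetric `Ψ` vanishing on `D`
with `⟨v,Ψ⟩ = 3V²`, every `0 < Δ` and every `T < 2ε₁`. -/
def KreinJFIdentity (Δ : ℝ) : Prop :=
  ∀ T : ℝ, T < 2 * eps1 L → ∀ Ψ : Cfg L → ℂ, IsSymm L (K1 L) Ψ → (∀ c, InD L c = true → Ψ c = 0) →
    ip L (fun c => 1 + phase L (K1 L) c.1 + phase L (K1 L) c.2) Ψ = (3 * ((L : ℂ) ^ 2) ^ 2) →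
    saddleS L T Δ (-(kreinCharge L T Δ Ψ)) =
      3 * ((L : ℝ) ^ 2) ^ 2 * T
        + (ip L Ψ (fun c => Happly L (K1 L) Δ Ψ c - ((eps1 L + T : ℝ) : ℂ) * Ψ c)).re
        - (Gform L T (residual L T Δ Ψ) (residual L T Δ Ψ)).re

/-! ## Ingredients of the MASTER INEQUALITY (memo 20 §284) — port targets
(MI): `3V²(Φ(T⁺) − T⁺) ≥ ⟨Ψ,(H−E)Ψ⟩ − (1 + 3Δ/ĝ₀)·⟨R',G^D R'⟩ ≥ ⟨Ψ,(H−E)Ψ⟩ − (1 + 3Δ/ĝ₀)·‖R'‖²/(2ε₁ − T⁺)`, from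
`KreinJFIdentity`, LEMMA L2 (`ĝ ≥ ĝ₀`) and the two elementary facts below. -/

/-- SHELL ≤ DIRICHLET FORM (port target, §284(b)(ii)): for `Y` vanishing on `D`, the weighted shell mass
`Σ_S W|Y|²` is bounded by the kinetic form `Re⟨Y, H₀ Y⟩` (each adjacent pair contributes the bonds that hop one
partner onto the other, where `Y = 0`). Here `H₀ = H0apply` (energies measured from `3ε(0) = 0`). -/
def ShellDirichletBound : Prop :=
  ∀ Y : Cfg L → ℂ, (∀ c, InD L c = true → Y c = 0) →
    (∑ c : Cfg L, (Wcount L c : ℝ) * ‖Y c‖ ^ 2) ≤ (ip L Y (H0apply L (K1 L) Y)).re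

/-- the three pole plane waves of the `K₁` fibre: momenta `(k₂,k₃) = (0,0), (K₁,0), (0,K₁)`. -/
noncomputable def poleWave (j : Fin 3) : Cfg L → ℂ := fun c =>
  match j with
  | 0 => 1
  | 1 => phase L (K1 L) c.1
  | 2 => phase L (K1 L) c.2

/-- POLE-COMPLEMENT GAP (port target, §284(b)(iii)): orthogonally to the three pole waves the free fibre
Hamiltonian is `≥ 3ε₁` (free gap, cf. `freeGap_K1`), hence `Re⟨Y,H₀Y⟩ ≤ 3·Re⟨Y,(H₀ − E)Y⟩` whenever `E ≤ 2ε₁`. -/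
def PoleComplementGap : Prop :=
  4 ≤ L → ∀ Y : Cfg L → ℂ, (∀ j : Fin 3, ip L (poleWave L j) Y = 0) →
    3 * eps1 L * (ip L Y Y).re ≤ (ip L Y (H0apply L (K1 L) Y)).re

/-! ## The trial gap in closed form (memo 20 §285) — port targets
Fibre coordinates `c = (a,b) = (r₁₂,r₁₃)`; the JF product state `Π(a,b) = f(a) f(b) f(b−a)` (K = 0, real) and the
`K₁` trial state `Ψ¹ = v·Π`, `v(a,b) = 1 + e^{iK₁·a} + e^{iK₁·b}`. -/

/-- the three-body product state built from a pair function `f`. -/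
def prodState (f : Tor L → ℝ) : Cfg L → ℂ := fun c => ((f c.1 * f c.2 * f (c.2 - c.1) : ℝ) : ℂ)

/-- DISCRETE IMS FORMULA (port target, §285(a)): for the `K₁` trial state `vΠ`,
`Re⟨vΠ, H₀^{K₁}(vΠ)⟩ = Re⟨|v|²Π, H₀^{0} Π⟩ + ε₁ Σ_c Π(c)[Π(a+x̂,b) + Π(a,b+x̂) + Π(a−x̂,b−x̂)]`
(the second term is `½ Σ_bonds |v(x)−v(y)|² Π(x)Π(y)`: only `x̂`-bonds contribute, each with `|1 − e^{iθ}|² = 2ε₁`).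
Exact for every real pair function `f`; with `f 0 = 0` both sides are hard-core (Dirichlet) forms. -/
def DiscreteIMS : Prop :=
  ∀ f : Tor L → ℝ,
    (ip L (fun c => vfun L c * prodState L f c) (H0apply L (K1 L) (fun c => vfun L c * prodState L f c))).re
      = (ip L (fun c => ((Complex.normSq (vfun L c) : ℝ) : ℂ) * prodState L f c) (H0apply L 0 (prodState L f))).re
        + eps1 L * (∑ c : Cfg L, prodState L f c *
            (prodState L f (c.1 + K1 L, c.2) + prodState L f (c.1, c.2 + K1 L)
              + prodState L f (c.1 - K1 L, c.2 - K1 L))).re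

/-- lattice Fourier transform `f̂(k) = Σ_r e^{−ik·r} f(r)`. -/
noncomputable def dft (f : Tor L → ℝ) (k : Tor L) : ℂ := ∑ r : Tor L, (starRingEnd ℂ) (phase L k r) * (f r : ℂ)

/-- TWO-MAGNON FOURIER IDENTITY (port target, §285(c)): if `f` vanishes at the origin, takes the common value
`f x̂` on the four nearest neighbours, and solves the `K = 0` two-magnon equation
`Σ_e (f(r) − f(r+e)) − Δ·1_{NN}(r) f(r) = λ₂ f(r)` for `r ≠ 0`, then for EVERY momentum `k`
`(2ε(k) − λ₂) f̂(k) = −f(x̂)·(4(1−Δ) + 2Δ ε(k))` (at `k = 0`: `λ₂ Σf = 4(1−Δ) f(x̂)`, the AFL identity). -/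
def TwoMagnonFourier (Δ lam2 : ℝ) : Prop :=
  ∀ f : Tor L → ℝ, f 0 = 0 → (∀ e ∈ nnList L, f e = f (K1 L)) →
    (∀ r : Tor L, r ≠ 0 →
      ((nnList L).map (fun e => f r - f (r + e))).sum - Δ * (if IsNN L r then 1 else 0) * f r = lam2 * f r) →
    ∀ k : Tor L, ((2 * epsT L k - lam2 : ℝ) : ℂ) * dft L f k
      = -((f (K1 L) * (4 * (1 - Δ) + 2 * Δ * epsT L k) : ℝ) : ℂ)

/-! ## The two ∀L cruxes of the (MI) proof of GM₃ (memo 20 §284–§287) — typed targets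
Everything is stated for the `K = 0` two-magnon (Jastrow factor) function `f` and its product state. -/

/-- `f` is the normalised `K = 0` two-magnon ground-state profile at anisotropy `Δ` with eigenvalue `λ₂`:
hard core `f 0 = 0`, lattice symmetry on the nearest neighbours, the two-magnon equation off the origin,
positivity at contact and normalisation `Σ f = V` (mean one). -/
def IsTwoMagnon (Δ lam2 : ℝ) (f : Tor L → ℝ) : Prop :=
  f 0 = 0 ∧ (∀ e ∈ nnList L, f e = f (K1 L)) ∧ 0 < f (K1 L) ∧ (∑ r : Tor L, f r) = (L : ℝ) ^ 2 ∧
    ∀ r : Tor L, r ≠ 0 →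
      ((nnList L).map (fun e => f r - f (r + e))).sum - Δ * (if IsNN L r then 1 else 0) * f r = lam2 * f r

/-- the `K₁` JF trial state `Ψ¹ = v·Π⁰`. -/
noncomputable def trialK1 (f : Tor L → ℝ) : Cfg L → ℂ := fun c => vfun L c * prodState L f c

/-- `T⁺` := the `K = 0` Rayleigh quotient of the product state (memo 20 §269/§272: `T⁺ = 3λ₂(1+δ₃)`). -/
noncomputable def Tplus (Δ : ℝ) (f : Tor L → ℝ) : ℝ := RQ L 0 Δ (prodState L f)

/-- `β := ⟨v, Ψ¹⟩ / (3V²)`, the pole overlap of the trial state. -/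
noncomputable def betaOverlap (f : Tor L → ℝ) : ℝ := (ip L (vfun L) (trialK1 L f)).re / (3 * ((L : ℝ) ^ 2) ^ 2)

/-- (KT-1) TRIAL-GAP LOWER BOUND (crux, memo 20 §285–§286; measured constant `≈ .65–.70`, limit `2/3⁺`):
`⟨Ψ¹, (H − ε₁ − T⁺) Ψ¹⟩ ≥ c · β² · 3V² T⁺`. -/
def TrialGapLB (Δ lam2 c : ℝ) : Prop :=
  ∀ f : Tor L → ℝ, IsTwoMagnon L Δ lam2 f →
    c * betaOverlap L f ^ 2 * (3 * ((L : ℝ) ^ 2) ^ 2) * Tplus L Δ f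
      ≤ (ip L (trialK1 L f) (Happly L (K1 L) Δ (trialK1 L f))).re
          - (eps1 L + Tplus L Δ f) * (ip L (trialK1 L f) (trialK1 L f)).re

/-- the off-`D` residual of the trial state with its three pole components projected out
(`‖p_j‖² = V²`; the pole-removed resolvent never sees them, memo 20 §287). -/
noncomputable def offPoleResidual (Δ : ℝ) (f : Tor L → ℝ) : Cfg L → ℂ := fun c =>
  residual L (Tplus L Δ f) Δ (trialK1 L f) c
    - ∑ j : Fin 3, (ip L (poleWave L j) (residual L (Tplus L Δ f) Δ (trialK1 L f)) / (((L : ℂ) ^ 2) ^ 2))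
        * poleWave L j c

/-- (KT-2) OFF-POLE RESIDUAL BOUND (crux, memo 20 §285(e)/§287; measured constant `κ' ≈ .05–.08`):
`‖Π′R′‖² ≤ κ · η_eff · (2ε₁ − T⁺) · 3V² T⁺ · β²` with `η_eff = V λ₂ / 4`. -/
def OffPoleResidualUB (Δ lam2 κ : ℝ) : Prop :=
  ∀ f : Tor L → ℝ, IsTwoMagnon L Δ lam2 f →
    (ip L (offPoleResidual L Δ f) (offPoleResidual L Δ f)).re
      ≤ κ * ((L : ℝ) ^ 2 * lam2 / 4) * (2 * eps1 L - Tplus L Δ f)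
          * (3 * ((L : ℝ) ^ 2) ^ 2) * Tplus L Δ f * betaOverlap L f ^ 2

/-- THE ∀L ASSEMBLY IN NUMBERS (memo 20 §287(c)): with `c₁ ≥ .64` and `κ' ≤ .12` the master inequality gives
`Φ(T⁺)/T⁺ − 1 ≥ .64 − (1 + 3Δ/ĝ₀)·.12·η_eff > 0` for all `Δ ∈ (0,1)`, `L ≥ 8`; this Prop records the target shape
`TrialGapLB .64 ∧ OffPoleResidualUB .12 → GM3Fibre` (the implication itself needs (MI): KreinJFIdentity, L2,
ShellDirichletBound, PoleComplementGap, KreinThree, PhiAntitone, NInvertibleBelow). -/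
def KTAssembly (Δ lam2 : ℝ) : Prop :=
  8 ≤ L → 0 < Δ → Δ < 1 → (∃ f : Tor L → ℝ, IsTwoMagnon L Δ lam2 f) →
    TrialGapLB L Δ lam2 0.64 → OffPoleResidualUB L Δ lam2 0.12 → GM3Fibre L Δ

end Summit.HubbardSuperconductivity.HubbardSuperconductivity.Theorems.AnisotropyChord.Transfer.Fibre3

end
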